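import Literature.Analysis.FluidPDE.FracNSApriori
import Literature.Analysis.FluidPDE.OnsagerBDSVStability33
import HarnessLib

/-!
# The De Rosa gluing stage: stability of the exact fractional Navier–Stokes solutions relative to
# `v_ℓ` (De Rosa 2019, Prop. 5.3)

L. De Rosa, *Infinitely many Leray–Hopf solutions for the fractional Navier–Stokes equations*,
Comm. PDE 44 (2019) 335–365 = arXiv:1801.10235, §5.2, Prop. 5.3 (stability and estimates on
`vᵢ - v_ℓ`): for `0 ≤ t - tᵢ ≤ 2τ_q`, (5.10) `‖vᵢ - v_ℓ‖_{N+α} ≲ τ_q δ_{q+1} ℓ^{-N-1+α}`,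
(5.11) `‖∇(p_ℓ - pᵢ)‖_{N+α} ≲ δ_{q+1} ℓ^{-N-1+α}`, (5.12) `‖D_{t,ℓ}(vᵢ - v_ℓ)‖_{N+α} ≲ δ_{q+1} ℓ^{-N-1+α}`.
The printed proof is that of Buckmaster–De Lellis–Székelyhidi–Vicol's Prop. 3.3 with the operator
`L_{t,ℓ,γ} = ∂ₜ + v_ℓ·∇ + ν(-Δ)^γ` in place of the material derivative: "we first consider (5.14)
with `N = 0` … by applying (3.6) [the maximum-principle Hölder estimate] … Grönwall … we obtain
(5.10) for `N = 0` … Next, consider the case `N ≥ 1` … commuting `∂^θ` with the material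
derivative … invoking once more (3.6) … Grönwall … we obtain (5.10). From (5.13) and (5.14) we then
also conclude (5.11) and (5.15) [the bound for `L_{t,ℓ,γ}(vᵢ - v_ℓ)`]", the pure material
derivative (5.12) following at the end with Thm. 7.1 and `τ_q ℓ^{-2γ-2α} ≤ 1`.

This file proves Prop. 5.3 in the dimensionless form of its Euler twin
`BDSV.holderCZBound.stability33` (`OnsagerBDSVStability33.lean`), whose architecture it follows
verbatim — the algebra of `w = v - v_ℓ` (`fracStability_transport_eq`: the transport–diffusion
equation `∂ₜw + (v_ℓ·∇)w + ν(-Δ)^γ w = -(w·∇)v - ∇(p - p_ℓ) - div R̊_ℓ`;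
`fracStability_laplacian_pressure_eq`; the pressure-gradient bound
`fracStability_gradient_pressure_le` with no normalisation of the pressures), and the
level-by-level estimate with absorption by De Rosa's maximum-principle estimates
(`Torus.eContDiffHolderNorm_fracTransport_higher`, forward in time, data `v(a) = v_ℓ(a)`):
`DeRosa.fracStability`. The Calderón–Zygmund input `BDSV.holderCZBound` is proved in the tree, so
the result is unconditional.

## References

* L. De Rosa, Comm. PDE 44 (2019) 335–365 = arXiv:1801.10235, §5.2: (5.9), Prop. 5.3
  (5.10)–(5.12) and its proof ((5.13)–(5.15), p. 12 of the arXiv text). [`Derosa2018`]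
* T. Buckmaster, C. De Lellis, L. Székelyhidi Jr., V. Vicol, CPAM 72 (2019) = arXiv:1701.08678,
  §3.2, Prop. 3.3, (3.9)–(3.13) (the Euler twin). [`BuckmasterEtAl2018`]
-/

noncomputable section

open MeasureTheory Set Filter Function
open scoped NNReal ENNReal ContDiff Topology

set_option maxSynthPendingDepth 3

namespace Literature.Analysis.FluidPDE

namespace DeRosa

open FunctionSpaces FunctionSpaces.Torus BDSV

/-! ## Algebra: the equations for `w = v - v_ℓ` and `p - p_ℓ` -/

section Equations

variable {a b : ℝ} {γ ν : ℝ} {vℓ v : ℝ → UnitAddTorus (Fin 3) → EuclideanSpace ℝ (Fin 3)}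
  {pℓ p : ℝ → UnitAddTorus (Fin 3) → ℝ}
  {Rℓ : ℝ → UnitAddTorus (Fin 3) → Fin 3 → EuclideanSpace ℝ (Fin 3)}


/-- **The transport–diffusion equation of `w = v - v_ℓ` along `v_ℓ`** (De Rosa 2019, proof of
Prop. 5.3: "`∂ₜ(v_ℓ - vᵢ) + v_ℓ·∇(v_ℓ - vᵢ) + ν(-Δ)^γ(v_ℓ - vᵢ) = -(v_ℓ - vᵢ)·∇vᵢ - ∇(p_ℓ - pᵢ) + div R̊_ℓ`",
sign of `w` reversed; BDSV (3.10) with the dissipation): for an exact solution `(v, p)` of the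
fractional Navier–Stokes system and a fractional Navier–Stokes–Reynolds triple `(v_ℓ, p_ℓ, R̊_ℓ)`
(same `γ ≥ 0`, `ν`) on `[a,b] × T³`,
`∂ₜw + (v_ℓ·∇)w + ν(-Δ)^γ w = -(w·∇)v - ∇(p - p_ℓ) - div R̊_ℓ`. [cite: Derosa2018, §5.2 proof of Prop. 5.3] -/
theorem fracStability_transport_eq (hab : a < b) (hγ : 0 ≤ γ) (hℓ : Torus.IsFracNSReynoldsOn (Icc a b) γ ν vℓ pℓ Rℓ)
    (hv : Torus.IsFracNSReynoldsOn (Icc a b) γ ν v p (fun _ _ _ => 0)) :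
    ∀ s ∈ Icc a b, ∀ x, FunctionSpaces.Torus.timeDerivWithin (Icc a b) (fun t y => v t y - vℓ t y) s x +
        FunctionSpaces.Torus.convect (vℓ s) (fun y => v s y - vℓ s y) x + ν • Torus.fracLaplacian γ (fun y => v s y - vℓ s y) x =
      -(FunctionSpaces.Torus.convect (fun y => v s y - vℓ s y) (v s) x) - FunctionSpaces.Torus.gradient (fun y => p s y - pℓ s y) x -
        Torus.tensorDivergence (Rℓ s) x := by
  intro s hs x
  have hΛ : Torus.fracLaplacian γ (v s - vℓ s) x =
      Torus.fracLaplacian γ (v s) x - Torus.fracLaplacian γ (vℓ s) x := by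
    have h := Torus.fracLaplacian_sub hγ (hv.smooth_velocity.isSmooth_slice hs) (hℓ.smooth_velocity.isSmooth_slice hs)
    exact congrFun h x
  have hU : UniqueDiffOn ℝ (Icc a b) := uniqueDiffOn_Icc hab
  have hvs : FunctionSpaces.Torus.IsSmooth (v s) := hv.smooth_velocity.isSmooth_slice hs
  have hℓs : FunctionSpaces.Torus.IsSmooth (vℓ s) := hℓ.smooth_velocity.isSmooth_slice hs
  have hps : FunctionSpaces.Torus.IsSmooth (p s) := hv.smooth_pressure.isSmooth_slice hs
  have hpℓs : FunctionSpaces.Torus.IsSmooth (pℓ s) := hℓ.smooth_pressure.isSmooth_slice hs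
  have h1 := hv.momentum s hs x
  rw [Torus.tensorDivergence_zero] at h1
  have h2 := hℓ.momentum s hs x
  rw [timeDerivWithin_sub' hv.smooth_velocity hℓ.smooth_velocity hU hs x,
    show (fun y => v s y - vℓ s y) = v s - vℓ s from rfl,
    convect_sub_right (isContDiff_one_of_isSmooth hvs) (isContDiff_one_of_isSmooth hℓs),
    convect_sub_left, gradient_sub' (isContDiff_one_of_isSmooth hps) (isContDiff_one_of_isSmooth hpℓs)]
  have e1 : FunctionSpaces.Torus.timeDerivWithin (Icc a b) v s x = -FunctionSpaces.Torus.convect (v s) (v s) x - FunctionSpaces.Torus.gradient (p s) x -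
      ν • Torus.fracLaplacian γ (v s) x := by
    rw [← sub_eq_zero]; rw [← h1]; abel
  have e2 : FunctionSpaces.Torus.timeDerivWithin (Icc a b) vℓ s x =
      Torus.tensorDivergence (Rℓ s) x - FunctionSpaces.Torus.convect (vℓ s) (vℓ s) x - FunctionSpaces.Torus.gradient (pℓ s) x -
        ν • Torus.fracLaplacian γ (vℓ s) x := by
    rw [← h2]; abel
  rw [e1, e2, hΛ, smul_sub]
  abel


/-- `w = v - v_ℓ` is divergence free. [folklore] -/
theorem fracStability_isDivFree_sub (hℓ : Torus.IsFracNSReynoldsOn (Icc a b) γ ν vℓ pℓ Rℓ)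
    (hv : Torus.IsFracNSReynoldsOn (Icc a b) γ ν v p (fun _ _ _ => 0)) {s : ℝ} (hs : s ∈ Icc a b) :
    FunctionSpaces.Torus.IsDivFree (fun y => v s y - vℓ s y) := by
  intro x
  have hvs : FunctionSpaces.Torus.IsSmooth (v s) := hv.smooth_velocity.isSmooth_slice hs
  have hℓs : FunctionSpaces.Torus.IsSmooth (vℓ s) := hℓ.smooth_velocity.isSmooth_slice hs
  rw [show (fun y => v s y - vℓ s y) = v s - vℓ s from rfl,
    FunctionSpaces.Torus.divergence_sub (isContDiff_one_of_isSmooth hvs) (isContDiff_one_of_isSmooth hℓs),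
    hv.divFree s hs x, hℓ.divFree s hs x, sub_zero]

/-- **The pressure equation of the difference** (BDSV (3.11), with `div((v_ℓ·∇)w) = div((w·∇)v_ℓ)`):

`Δ(p - p_ℓ) = -div((w·∇)(v_ℓ + v)) - div(div R̊_ℓ)` on `[a,b] × T³`. [cite: Derosa2018, §5.2 (proof of Prop. 5.3, the pressure equation)] -/
theorem fracStability_laplacian_pressure_eq (hab : a < b) (hγ : 0 ≤ γ) (hℓ : Torus.IsFracNSReynoldsOn (Icc a b) γ ν vℓ pℓ Rℓ)
    (hv : Torus.IsFracNSReynoldsOn (Icc a b) γ ν v p (fun _ _ _ => 0)) {s : ℝ} (hs : s ∈ Icc a b) (x : UnitAddTorus (Fin 3)) :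
    FunctionSpaces.Torus.laplacian (fun y => p s y - pℓ s y) x =
      -FunctionSpaces.Torus.divergence (FunctionSpaces.Torus.convect (fun y => v s y - vℓ s y) (vℓ s + v s)) x -
        FunctionSpaces.Torus.divergence (Torus.tensorDivergence (Rℓ s)) x := by
  have hvs : FunctionSpaces.Torus.IsSmooth (v s) := hv.smooth_velocity.isSmooth_slice hs
  have hℓs : FunctionSpaces.Torus.IsSmooth (vℓ s) := hℓ.smooth_velocity.isSmooth_slice hs
  have hps : FunctionSpaces.Torus.IsSmooth (p s) := hv.smooth_pressure.isSmooth_slice hs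
  have hpℓs : FunctionSpaces.Torus.IsSmooth (pℓ s) := hℓ.smooth_pressure.isSmooth_slice hs
  have hws : FunctionSpaces.Torus.IsSmooth (fun y => v s y - vℓ s y) := hvs.sub hℓs
  have hR0 : Torus.tensorDivergence (fun (_ : UnitAddTorus (Fin 3)) (_ : Fin 3) =>
      (0 : EuclideanSpace ℝ (Fin 3))) = fun _ => 0 := funext fun x => Torus.tensorDivergence_zero x
  have hLp : FunctionSpaces.Torus.laplacian (p s) x = -FunctionSpaces.Torus.divergence (FunctionSpaces.Torus.convect (v s) (v s)) x := by
    rw [DeRosa.fracNS_laplacian_pressure_eq hab hγ hv hs x, hR0, Torus.divergence_zero, zero_sub]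
  have hLℓ : FunctionSpaces.Torus.laplacian (pℓ s) x = FunctionSpaces.Torus.divergence (Torus.tensorDivergence (Rℓ s)) x -
      FunctionSpaces.Torus.divergence (FunctionSpaces.Torus.convect (vℓ s) (vℓ s)) x := DeRosa.fracNS_laplacian_pressure_eq hab hγ hℓ hs x
  -- `Δ(p - p_ℓ) = Δp - Δp_ℓ`
  have hsub : FunctionSpaces.Torus.laplacian (fun y => p s y - pℓ s y) x = FunctionSpaces.Torus.laplacian (p s) x - FunctionSpaces.Torus.laplacian (pℓ s) x := by
    have h : (fun y => p s y - pℓ s y) = p s + -pℓ s := by funext y; simp [sub_eq_add_neg]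
    rw [h, laplacian_add_apply hps hpℓs.neg, laplacian_neg_apply hpℓs, ← sub_eq_add_neg]
  -- the convective terms
  have hconv : FunctionSpaces.Torus.divergence (FunctionSpaces.Torus.convect (v s) (v s)) x - FunctionSpaces.Torus.divergence (FunctionSpaces.Torus.convect (vℓ s) (vℓ s)) x =
      FunctionSpaces.Torus.divergence (FunctionSpaces.Torus.convect (fun y => v s y - vℓ s y) (vℓ s + v s)) x := by
    have h1 : FunctionSpaces.Torus.IsContDiff 1 (v s) := isContDiff_one_of_isSmooth hvs
    have h2 : FunctionSpaces.Torus.IsContDiff 1 (vℓ s) := isContDiff_one_of_isSmooth hℓs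
    have hc1 : FunctionSpaces.Torus.IsContDiff 1 (FunctionSpaces.Torus.convect (vℓ s) (fun y => v s y - vℓ s y)) :=
      isContDiff_one_of_isSmooth (hℓs.convect hws)
    have hc2 : FunctionSpaces.Torus.IsContDiff 1 (FunctionSpaces.Torus.convect (fun y => v s y - vℓ s y) (v s)) :=
      isContDiff_one_of_isSmooth (hws.convect hvs)
    have hc3 : FunctionSpaces.Torus.IsContDiff 1 (FunctionSpaces.Torus.convect (fun y => v s y - vℓ s y) (vℓ s)) :=
      isContDiff_one_of_isSmooth (hws.convect hℓs)
    -- `(v·∇)v - (v_ℓ·∇)v_ℓ = (v_ℓ·∇)w + (w·∇)v`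
    have hpt : FunctionSpaces.Torus.convect (v s) (v s) - FunctionSpaces.Torus.convect (vℓ s) (vℓ s) =
        FunctionSpaces.Torus.convect (vℓ s) (fun y => v s y - vℓ s y) + FunctionSpaces.Torus.convect (fun y => v s y - vℓ s y) (v s) := by
      funext y
      rw [Pi.sub_apply, Pi.add_apply, show (fun y => v s y - vℓ s y) = v s - vℓ s from rfl,
        convect_sub_right h1 h2, convect_sub_left]
      abel
    rw [← FunctionSpaces.Torus.divergence_sub (isContDiff_one_of_isSmooth (hvs.convect hvs))
      (isContDiff_one_of_isSmooth (hℓs.convect hℓs)), hpt, divergence_add' hc1 hc2,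
      divergence_convect_comm hℓs hws (hℓ.divFree s hs) (fracStability_isDivFree_sub hℓ hv hs) x,
      ← divergence_add' hc3 hc2]
    congr 1
    funext y
    rw [Pi.add_apply, convect_add_right h2 h1]
  rw [hsub, hLp, hLℓ, ← hconv]
  ring

end Equations

/-! ## Bounds for the forcing terms -/

section Bounds

/-- **Pressure-gradient bound for the difference** (BDSV (3.12)–(3.13) before inserting the
bounds on `v_ℓ`, `vᵢ`): from `BDSV.holderCZBound`, for `0 < α < 1` and `N` there is `C` with
`‖∇(p - p_ℓ)‖_{N,α} ≤ C (‖(w·∇)(v_ℓ + v)‖_{N,α} + ‖div R̊_ℓ‖_{N,α})`. [cite: Derosa2018, §5.2 proof of Prop. 5.3 ((5.11) via the pressure equation)] -/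
theorem fracStability_gradient_pressure_le {α : ℝ≥0} (hα : 0 < α)
    (hα1 : α < 1) (N : ℕ) :
    ∃ C : ℝ≥0, ∀ {a b : ℝ} (_ : a < b) {vℓ v : ℝ → UnitAddTorus (Fin 3) → EuclideanSpace ℝ (Fin 3)}
      {pℓ p : ℝ → UnitAddTorus (Fin 3) → ℝ} {Rℓ : ℝ → UnitAddTorus (Fin 3) → Fin 3 → EuclideanSpace ℝ (Fin 3)} {γ ν : ℝ} (_ : 0 ≤ ν) (_ : 0 < γ) (_ : γ < 1)
      (_ : Torus.IsFracNSReynoldsOn (Icc a b) γ ν vℓ pℓ Rℓ) (_ : Torus.IsFracNSReynoldsOn (Icc a b) γ ν v p (fun _ _ _ => 0)),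
      ∀ s ∈ Icc a b, Torus.eContDiffHolderNorm N α (FunctionSpaces.Torus.gradient (fun y => p s y - pℓ s y)) ≤
        C * (Torus.eContDiffHolderNorm N α (FunctionSpaces.Torus.convect (fun y => v s y - vℓ s y) (vℓ s + v s)) +
          Torus.eContDiffHolderNorm N α (Torus.tensorDivergence (Rℓ s))) := by
  obtain ⟨C, hC⟩ := holderCZBound_holds.rieszHessian_le hα hα1 N
  refine ⟨9 * C, ?_⟩
  intro a b hab vℓ v pℓ p Rℓ γ ν hν hγ0 hγ1 hℓ hv s hs
  have hvs : FunctionSpaces.Torus.IsSmooth (v s) := hv.smooth_velocity.isSmooth_slice hs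
  have hℓs : FunctionSpaces.Torus.IsSmooth (vℓ s) := hℓ.smooth_velocity.isSmooth_slice hs
  have hps : FunctionSpaces.Torus.IsSmooth (p s) := hv.smooth_pressure.isSmooth_slice hs
  have hpℓs : FunctionSpaces.Torus.IsSmooth (pℓ s) := hℓ.smooth_pressure.isSmooth_slice hs
  have hws : FunctionSpaces.Torus.IsSmooth (fun y => v s y - vℓ s y) := hvs.sub hℓs
  have hRs : FunctionSpaces.Torus.IsSmooth (Rℓ s) := hℓ.smooth_stress.isSmooth_slice hs
  set B : UnitAddTorus (Fin 3) → EuclideanSpace ℝ (Fin 3) := fun x =>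
    FunctionSpaces.Torus.convect (fun y => v s y - vℓ s y) (vℓ s + v s) x + Torus.tensorDivergence (Rℓ s) x with hBdef
  have hB1 : FunctionSpaces.Torus.IsSmooth (FunctionSpaces.Torus.convect (fun y => v s y - vℓ s y) (vℓ s + v s)) := hws.convect (hℓs.add hvs)
  have hB2 : FunctionSpaces.Torus.IsSmooth (Torus.tensorDivergence (Rℓ s)) := hRs.tensorDivergence
  have hB : FunctionSpaces.Torus.IsSmooth B := hB1.add hB2
  have hdivB : FunctionSpaces.Torus.divergence B = fun x => FunctionSpaces.Torus.divergence (FunctionSpaces.Torus.convect (fun y => v s y - vℓ s y) (vℓ s + v s)) x +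
      FunctionSpaces.Torus.divergence (Torus.tensorDivergence (Rℓ s)) x := by
    funext x
    exact divergence_add' (isContDiff_one_of_isSmooth hB1) (isContDiff_one_of_isSmooth hB2) x
  -- the pressure difference up to its mean: `(p - p_ℓ) - ∫(p - p_ℓ) = -Δ⁻¹ div B`
  have hqs : FunctionSpaces.Torus.IsSmooth (fun y => p s y - pℓ s y) := hps.sub hpℓs
  have hlapq : FunctionSpaces.Torus.laplacian (fun y => p s y - pℓ s y) = -FunctionSpaces.Torus.divergence B := by
    funext x
    rw [fracStability_laplacian_pressure_eq hab hγ0.le hℓ hv hs x, hdivB, Pi.neg_apply]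
    ring
  have hq : (fun y => (p s y - pℓ s y) - ∫ z, (p s z - pℓ s z)) = -FunctionSpaces.Torus.invLaplacian (FunctionSpaces.Torus.divergence B) := by
    funext y
    rw [← invLaplacian_laplacian hqs y, hlapq, invLaplacian_neg hB.divergence]
  -- each partial derivative of `p - p_ℓ`
  have hpm : ∀ m, Torus.eContDiffHolderNorm N α (FunctionSpaces.Torus.partialDeriv m (fun y => p s y - pℓ s y)) ≤
      3 * C * Torus.eContDiffHolderNorm N α B := by
    intro m
    have h1 : FunctionSpaces.Torus.partialDeriv m (fun y => p s y - pℓ s y) = -fun x => ∑ k, rieszHessian m k (fun y => B y k) x := by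
      rw [← partialDeriv_invLaplacian_divergence hB m]
      funext x
      rw [← DeRosa.partialDeriv_sub_const (∫ z, (p s z - pℓ s z)) m x, hq, Pi.neg_apply,
        ← partialDeriv_neg m _ x]
      rfl
    rw [h1, Torus.eContDiffHolderNorm_neg]
    have hfun : (fun x => ∑ k, rieszHessian m k (fun y => B y k) x) = ∑ k, rieszHessian m k (fun y => B y k) := by
      funext x; simp only [Finset.sum_apply]
    rw [hfun]
    calc Torus.eContDiffHolderNorm N α (∑ k, rieszHessian m k (fun y => B y k))
        ≤ ∑ k, Torus.eContDiffHolderNorm N α (rieszHessian m k (fun y => B y k)) :=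
          Torus.eContDiffHolderNorm_sum_le Finset.univ fun k _ =>
            isContDiff_nat_of_isSmooth (isSmooth_rieszHessian (hB.apply k) m k) N
      _ ≤ ∑ _k : Fin 3, (C : ℝ≥0∞) * Torus.eContDiffHolderNorm N α B :=
          Finset.sum_le_sum fun k _ => (hC m k _ (hB.apply k)).trans
            (mul_le_mul' le_rfl (eContDiffHolderNorm_coord_le hB N α k))
      _ = 3 * C * Torus.eContDiffHolderNorm N α B := by
          simp only [Finset.sum_const, Finset.card_univ, Fintype.card_fin, nsmul_eq_mul]
          push_cast
          ring
  have hBle : Torus.eContDiffHolderNorm N α B ≤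
      Torus.eContDiffHolderNorm N α (FunctionSpaces.Torus.convect (fun y => v s y - vℓ s y) (vℓ s + v s)) +
        Torus.eContDiffHolderNorm N α (Torus.tensorDivergence (Rℓ s)) :=
    Torus.eContDiffHolderNorm_add_le (isContDiff_nat_of_isSmooth hB1 N) (isContDiff_nat_of_isSmooth hB2 N)
  calc Torus.eContDiffHolderNorm N α (FunctionSpaces.Torus.gradient (fun y => p s y - pℓ s y))
      ≤ ∑ m, Torus.eContDiffHolderNorm N α (FunctionSpaces.Torus.partialDeriv m (fun y => p s y - pℓ s y)) :=
        eContDiffHolderNorm_gradient_le_sum (hps.sub hpℓs) N α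
    _ ≤ ∑ _m : Fin 3, 3 * (C : ℝ≥0∞) * Torus.eContDiffHolderNorm N α B := Finset.sum_le_sum fun m _ => hpm m
    _ = ((9 * C : ℝ≥0) : ℝ≥0∞) * Torus.eContDiffHolderNorm N α B := by
        simp only [Finset.sum_const, Finset.card_univ, Fintype.card_fin, nsmul_eq_mul]
        push_cast
        ring
    _ ≤ _ := mul_le_mul' le_rfl hBle

end Bounds

/-! ## The level-`N` estimate for `w = v - v_ℓ` -/

section Level

set_option maxHeartbeats 1000000 in
/-- **De Rosa Prop. 5.3 (5.10), level `N`, given the lower levels** (twin of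
`BDSV.holderCZBound.stability33_level`: the transport–diffusion estimate for `∂^θw` with the
commutator and forcing bounds, absorbed under the CFL smallness; De Rosa: "invoking once more (3.6)
… and hence, using Grönwall's inequality and the assumption `0 ≤ t - tᵢ ≤ 2τ_q` we obtain (5.10)"):
for
`0 < α < 1`, `N` and a constant `CΦ` for the levels `< N`, there are `c > 0`, `C ≥ 0` such that
for `(v_ℓ, p_ℓ, R̊_ℓ)` fractional Navier–Stokes–Reynolds and `(v, p)` exact fractional Navier–Stokes
(`ν ≥ 0`, `0 < γ < 1`) on `[a,b] × T³` with `v(a) = v_ℓ(a)`, `‖v_ℓ(s)‖_{m,α}, ‖v(s)‖_{m,α} ≤ U Λ^{m-1}` (`1 ≤ m ≤ N+1`),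
`‖R̊_ℓ(s)‖_{N+1,α} ≤ E Λ^{N+1}`, `‖w(s)‖_{m,α} ≤ CΦ (b-a) E Λ^{m+1}` (`m < N`) and `(b-a)U ≤ c`:
`‖w(s)‖_{N,α} ≤ C (b-a) E Λ^{N+1}` on `[a,b]`. [cite: Derosa2018, §5.2 Prop. 5.3 (5.10)] -/
theorem fracStability_level {α : ℝ≥0} (hα : 0 < α) (hα1 : α < 1)
    (N : ℕ) {CΦ : ℝ} (hCΦ : 0 ≤ CΦ) :
    ∃ c : ℝ, 0 < c ∧ ∃ C : ℝ, 0 ≤ C ∧ ∀ {a b : ℝ} (_ : a < b)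
      {vℓ v : ℝ → UnitAddTorus (Fin 3) → EuclideanSpace ℝ (Fin 3)} {pℓ p : ℝ → UnitAddTorus (Fin 3) → ℝ}
      {Rℓ : ℝ → UnitAddTorus (Fin 3) → Fin 3 → EuclideanSpace ℝ (Fin 3)} {γ ν : ℝ} (_ : 0 ≤ ν) (_ : 0 < γ) (_ : γ < 1)
      (_ : Torus.IsFracNSReynoldsOn (Icc a b) γ ν vℓ pℓ Rℓ) (_ : Torus.IsFracNSReynoldsOn (Icc a b) γ ν v p (fun _ _ _ => 0))
      (_ : v a = vℓ a) {U Λ E : ℝ} (_ : 0 < U) (_ : 1 ≤ Λ) (_ : 0 ≤ E)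
      (_ : ∀ s ∈ Icc a b, ∀ m, 1 ≤ m → m ≤ N + 1 →
        Torus.eContDiffHolderNorm m α (vℓ s) ≤ ENNReal.ofReal (U * Λ ^ (m - 1)))
      (_ : ∀ s ∈ Icc a b, ∀ m, 1 ≤ m → m ≤ N + 1 →
        Torus.eContDiffHolderNorm m α (v s) ≤ ENNReal.ofReal (U * Λ ^ (m - 1)))
      (_ : ∀ s ∈ Icc a b, Torus.eContDiffHolderNorm (N + 1) α (Rℓ s) ≤ ENNReal.ofReal (E * Λ ^ (N + 1)))
      (_ : ∀ s ∈ Icc a b, ∀ m, m < N →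
        Torus.eContDiffHolderNorm m α (fun y => v s y - vℓ s y) ≤ ENNReal.ofReal (CΦ * (b - a) * E * Λ ^ (m + 1)))
      (_ : (b - a) * U ≤ c),
      ∀ s ∈ Icc a b, Torus.eContDiffHolderNorm N α (fun y => v s y - vℓ s y) ≤
        ENNReal.ofReal (C * (b - a) * E * Λ ^ (N + 1)) := by
  obtain ⟨A, hA1, hTN⟩ := Torus.eContDiffHolderNorm_fracTransport_higher (d := Fin 3) N
  obtain ⟨CR, hCR⟩ := fracStability_gradient_pressure_le hα hα1 N
  have hA0 : 0 < A := by linarith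
  obtain ⟨P₂, hP₂def⟩ : ∃ P₂ : ℝ, P₂ = 3 ^ N * ((N + 1) * 2) * (1 + CR) := ⟨_, rfl⟩
  have hP₂0 : 0 ≤ P₂ := by rw [hP₂def]; positivity
  obtain ⟨P₁, hP₁def⟩ : ∃ P₁ : ℝ, P₁ = P₂ * (N * CΦ) + 3 * (CR + 1) + N * CΦ := ⟨_, rfl⟩
  have hP₁0 : 0 ≤ P₁ := by rw [hP₁def]; positivity
  have hden : 0 < 2 * A * P₂ + 1 := by positivity
  obtain ⟨c, hcdef⟩ : ∃ c : ℝ, c = min (1 / 2) (min (1 / A) (1 / (2 * A * P₂ + 1))) := ⟨_, rfl⟩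
  have hc0 : 0 < c := by rw [hcdef]; exact lt_min (by norm_num) (lt_min (by positivity) (one_div_pos.2 hden))
  have hc1 : c ≤ 1 / 2 := by rw [hcdef]; exact min_le_left _ _
  have hc2 : c ≤ 1 / A := by rw [hcdef]; exact (min_le_right _ _).trans (min_le_left _ _)
  have hc3 : c ≤ 1 / (2 * A * P₂ + 1) := by rw [hcdef]; exact (min_le_right _ _).trans (min_le_right _ _)
  have hcle1 : c ≤ 1 := hc1.trans (by norm_num)
  refine ⟨c, hc0, 2 * A * P₁, by positivity, ?_⟩
  intro a b hab vℓ v pℓ p Rℓ γ ν hν hγ0 hγ1 hℓ hv hanchor U Λ E hU hΛ hE hvℓ hvv hR hΦ hc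
  have ht₀ : a ∈ Icc a b := left_mem_Icc.2 hab.le
  have hL : 0 < b - a := sub_pos.2 hab
  set L := b - a with hLdef
  have hLU : L * U ≤ c := hc
  have hLU1 : L * U ≤ 1 := hLU.trans hcle1
  have hU0 : 0 ≤ U := hU.le
  have hΛ0 : 0 ≤ Λ := zero_le_one.trans hΛ
  have hUJ : UniqueDiffOn ℝ (Icc a b) := uniqueDiffOn_Icc hab
  have hvs : ∀ s ∈ Icc a b, FunctionSpaces.Torus.IsSmooth (v s) := fun s hs => hv.smooth_velocity.isSmooth_slice hs
  have hℓs : ∀ s ∈ Icc a b, FunctionSpaces.Torus.IsSmooth (vℓ s) := fun s hs => hℓ.smooth_velocity.isSmooth_slice hs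
  have hRs : ∀ s ∈ Icc a b, FunctionSpaces.Torus.IsSmooth (Rℓ s) := fun s hs => hℓ.smooth_stress.isSmooth_slice hs
  -- the transported field and its forcing
  set W : ℝ → UnitAddTorus (Fin 3) → EuclideanSpace ℝ (Fin 3) := fun t y => v t y - vℓ t y with hWdef
  have hW : FunctionSpaces.Torus.IsSmoothSpaceTimeOn (Icc a b) W := hv.smooth_velocity.sub hℓ.smooth_velocity
  have hWs : ∀ s ∈ Icc a b, FunctionSpaces.Torus.IsSmooth (W s) := fun s hs => hW.isSmooth_slice hs
  set G : ℝ → UnitAddTorus (Fin 3) → EuclideanSpace ℝ (Fin 3) := fun s x => -(FunctionSpaces.Torus.convect (W s) (v s) x) -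
      FunctionSpaces.Torus.gradient (fun y => p s y - pℓ s y) x - Torus.tensorDivergence (Rℓ s) x with hGdef
  have hRdiv : FunctionSpaces.Torus.IsSmoothSpaceTimeOn (Icc a b) (fun t => Torus.tensorDivergence (Rℓ t)) :=
    FunctionSpaces.Torus.IsSmoothSpaceTimeOn.sum fun j _ =>
      (hℓ.smooth_stress.clm_comp (ContinuousLinearMap.proj (R := ℝ)
        (φ := fun _ : Fin 3 => EuclideanSpace ℝ (Fin 3)) j)).partialDeriv hUJ j
  have hG : FunctionSpaces.Torus.IsSmoothSpaceTimeOn (Icc a b) G :=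
    (((hW.convect hv.smooth_velocity hUJ).neg).sub ((hv.smooth_pressure.sub hℓ.smooth_pressure).gradient hUJ)).sub hRdiv
  have heq : ∀ s ∈ Icc a b, ∀ x, FunctionSpaces.Torus.timeDerivWithin (Icc a b) W s x + FunctionSpaces.Torus.convect (vℓ s) (W s) x +
      ν • Torus.fracLaplacian γ (W s) x = G s x :=
    fun s hs x => fracStability_transport_eq hab hγ0.le hℓ hv s hs x
  have hGform : ∀ s ∈ Icc a b, G s = fun x => -(FunctionSpaces.Torus.convect (W s) (v s) x) -
      FunctionSpaces.Torus.gradient (fun y => p s y - pℓ s y) x - Torus.tensorDivergence (Rℓ s) x := fun s hs => rfl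
  -- finiteness and the supremum `M` of the level-`N` norms of `W`
  obtain ⟨Bfin, hBfin0, hBfin⟩ := BDSV.exists_forall_eContDiffHolderNorm_le_of_Icc hab N hα1.le hW
  set S := ⨆ s ∈ Icc a b, Torus.eContDiffHolderNorm N α (W s) with hSdef
  have hSle : S ≤ ENNReal.ofReal Bfin := iSup₂_le fun s hs => hBfin s hs
  have hST : S ≠ ⊤ := ne_top_of_le_ne_top ENNReal.ofReal_ne_top hSle
  obtain ⟨M, hMdef⟩ : ∃ M : ℝ, M = S.toReal := ⟨_, rfl⟩
  have hM0 : 0 ≤ M := by rw [hMdef]; exact ENNReal.toReal_nonneg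
  have hMS : ENNReal.ofReal M = S := by rw [hMdef, ENNReal.ofReal_toReal hST]
  have hWM : ∀ s ∈ Icc a b, Torus.eContDiffHolderNorm N α (W s) ≤ ENNReal.ofReal M := by
    intro s hs
    rw [hMS]
    exact le_iSup₂ (f := fun s _ => Torus.eContDiffHolderNorm N α (W s)) s hs
  -- bounds on all the levels `≤ N` of `W`
  obtain ⟨T, hTdef⟩ : ∃ T : ℝ, T = N * CΦ * E * Λ ^ (N + 1) + U * M := ⟨_, rfl⟩
  have hT0 : 0 ≤ T := by rw [hTdef]; positivity
  have hWj : ∀ s ∈ Icc a b, ∀ j, j ≤ N →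
      Torus.eContDiffHolderNorm j α (W s) * ENNReal.ofReal (U * Λ ^ (N - j)) ≤ ENNReal.ofReal T := by
    intro s hs j hj
    have hT2 : U * M ≤ T := by rw [hTdef]; exact le_add_of_nonneg_left (by positivity)
    rcases Nat.lt_or_eq_of_le hj with hjN | hjeq
    · have hT1 : CΦ * E * Λ ^ (N + 1) * (L * U) ≤ T := by
        rw [hTdef]
        have hNpos : 0 < N := lt_of_le_of_lt (Nat.zero_le j) hjN
        have hN1 : (1 : ℝ) ≤ N := by exact_mod_cast hNpos
        have hQ : 0 ≤ CΦ * E * Λ ^ (N + 1) := by positivity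
        have h1 : CΦ * E * Λ ^ (N + 1) * (L * U) ≤ CΦ * E * Λ ^ (N + 1) * 1 :=
          mul_le_mul_of_nonneg_left hLU1 hQ
        nlinarith [mul_nonneg hU0 hM0]
      calc _ ≤ ENNReal.ofReal (CΦ * L * E * Λ ^ (j + 1)) * ENNReal.ofReal (U * Λ ^ (N - j)) :=
            mul_le_mul' (hΦ s hs j hjN) le_rfl
        _ = ENNReal.ofReal (CΦ * E * Λ ^ (N + 1) * (L * U)) := by
            rw [← ENNReal.ofReal_mul (by positivity)]
            congr 1
            have hpow : Λ ^ (j + 1) * Λ ^ (N - j) = Λ ^ (N + 1) := by rw [← pow_add]; congr 1; omega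
            calc CΦ * L * E * Λ ^ (j + 1) * (U * Λ ^ (N - j)) = CΦ * E * (Λ ^ (j + 1) * Λ ^ (N - j)) * (L * U) := by ring
              _ = _ := by rw [hpow]
        _ ≤ ENNReal.ofReal T := ENNReal.ofReal_le_ofReal hT1
    · rw [hjeq, Nat.sub_self, pow_zero, mul_one]
      calc _ ≤ ENNReal.ofReal M * ENNReal.ofReal U := mul_le_mul' (hWM s hs) le_rfl
        _ = ENNReal.ofReal (U * M) := by rw [← ENNReal.ofReal_mul hM0]; congr 1; ring
        _ ≤ ENNReal.ofReal T := ENNReal.ofReal_le_ofReal hT2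
  -- the convective terms
  have hconv : ∀ s ∈ Icc a b, ∀ (u : UnitAddTorus (Fin 3) → EuclideanSpace ℝ (Fin 3)), FunctionSpaces.Torus.IsSmooth u →
      (∀ m, 1 ≤ m → m ≤ N + 1 → Torus.eContDiffHolderNorm m α u ≤ ENNReal.ofReal (2 * U * Λ ^ (m - 1))) →
      Torus.eContDiffHolderNorm N α (FunctionSpaces.Torus.convect (W s) u) ≤ ENNReal.ofReal (3 ^ N * ((N + 1) * (2 * T))) := by
    intro s hs u hu hub
    have h := Torus.eContDiffHolderNorm_convect_le (u := W s) (v := u)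
      (isContDiff_nat_of_isSmooth (hWs s hs) N) (isContDiff_nat_of_isSmooth hu (N + 1)) α (k := N)
    refine h.trans ?_
    have hterm : ∀ j ∈ Finset.range (N + 1), Torus.eContDiffHolderNorm j α (W s) *
        Torus.eContDiffHolderNorm (N - j + 1) α u ≤ ENNReal.ofReal (2 * T) := by
      intro j hj
      have hjN : j ≤ N := Nat.lt_succ_iff.1 (Finset.mem_range.1 hj)
      calc _ ≤ Torus.eContDiffHolderNorm j α (W s) * ENNReal.ofReal (2 * U * Λ ^ (N - j)) := by
            refine mul_le_mul' le_rfl ?_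
            have h := hub (N - j + 1) (Nat.le_add_left 1 _) (by omega)
            rwa [Nat.add_sub_cancel] at h
        _ = 2 * (Torus.eContDiffHolderNorm j α (W s) * ENNReal.ofReal (U * Λ ^ (N - j))) := by
            rw [show 2 * U * Λ ^ (N - j) = 2 * (U * Λ ^ (N - j)) by ring, ENNReal.ofReal_mul (by norm_num),
              ENNReal.ofReal_ofNat]
            ring
        _ ≤ 2 * ENNReal.ofReal T := mul_le_mul' le_rfl (hWj s hs j hjN)
        _ = ENNReal.ofReal (2 * T) := by
            rw [ENNReal.ofReal_mul (by norm_num : (0:ℝ) ≤ 2), ENNReal.ofReal_ofNat]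
    calc (3 : ℝ≥0∞) ^ N * ∑ j ∈ Finset.range (N + 1), Torus.eContDiffHolderNorm j α (W s) *
          Torus.eContDiffHolderNorm (N - j + 1) α u
        ≤ 3 ^ N * ∑ _j ∈ Finset.range (N + 1), ENNReal.ofReal (2 * T) :=
          mul_le_mul' le_rfl (Finset.sum_le_sum hterm)
      _ = ENNReal.ofReal (3 ^ N * ((N + 1) * (2 * T))) := by
          rw [Finset.sum_const, Finset.card_range, nsmul_eq_mul]
          rw [ENNReal.ofReal_mul (by positivity : (0 : ℝ) ≤ 3 ^ N), ENNReal.ofReal_pow (by norm_num : (0 : ℝ) ≤ 3),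
            ENNReal.ofReal_ofNat, ENNReal.ofReal_mul (by positivity : (0 : ℝ) ≤ (N : ℝ) + 1),
            show ((N : ℝ) + 1) = ((N + 1 : ℕ) : ℝ) by push_cast; ring, ENNReal.ofReal_natCast]
  have hvb : ∀ s ∈ Icc a b, ∀ m, 1 ≤ m → m ≤ N + 1 →
      Torus.eContDiffHolderNorm m α (v s) ≤ ENNReal.ofReal (2 * U * Λ ^ (m - 1)) := fun s hs m hm hmN =>
    (hvv s hs m hm hmN).trans (ENNReal.ofReal_le_ofReal (by nlinarith [pow_nonneg hΛ0 (m - 1)]))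
  have hsumb : ∀ s ∈ Icc a b, ∀ m, 1 ≤ m → m ≤ N + 1 →
      Torus.eContDiffHolderNorm m α (vℓ s + v s) ≤ ENNReal.ofReal (2 * U * Λ ^ (m - 1)) := by
    intro s hs m hm hmN
    refine (Torus.eContDiffHolderNorm_add_le (isContDiff_nat_of_isSmooth (hℓs s hs) m)
      (isContDiff_nat_of_isSmooth (hvs s hs) m)).trans ?_
    rw [show 2 * U * Λ ^ (m - 1) = U * Λ ^ (m - 1) + U * Λ ^ (m - 1) by ring,
      ENNReal.ofReal_add (by positivity) (by positivity)]
    exact add_le_add (hvℓ s hs m hm hmN) (hvv s hs m hm hmN)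
  -- the stress term
  have hdivR : ∀ s ∈ Icc a b, Torus.eContDiffHolderNorm N α (Torus.tensorDivergence (Rℓ s)) ≤
      ENNReal.ofReal (3 * (E * Λ ^ (N + 1))) := by
    intro s hs
    refine (eContDiffHolderNorm_tensorDivergence_le (hRs s hs) N α).trans ?_
    rw [ENNReal.ofReal_mul (by norm_num), ENNReal.ofReal_ofNat]
    exact mul_le_mul' le_rfl (hR s hs)
  -- the forcing bound
  obtain ⟨G₀, hG₀def⟩ : ∃ G₀ : ℝ, G₀ = 3 ^ N * ((N + 1) * (2 * T)) * (1 + CR) +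
      (CR + 1) * (3 * (E * Λ ^ (N + 1))) := ⟨_, rfl⟩
  have hG₀0 : 0 ≤ G₀ := by rw [hG₀def]; positivity
  have hGb : ∀ s ∈ Icc a b, Torus.eContDiffHolderNorm N α (G s) ≤ ENNReal.ofReal G₀ := by
    intro s hs
    rw [hGform s hs]
    have hc1' : FunctionSpaces.Torus.IsContDiff N (fun x => -(FunctionSpaces.Torus.convect (W s) (v s) x)) :=
      isContDiff_nat_of_isSmooth ((hWs s hs).convect (hvs s hs)).neg N
    have hq : FunctionSpaces.Torus.IsSmooth (FunctionSpaces.Torus.gradient (fun y => p s y - pℓ s y)) :=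
      ((hv.smooth_pressure.isSmooth_slice hs).sub (hℓ.smooth_pressure.isSmooth_slice hs)).gradient
    have hc2' : FunctionSpaces.Torus.IsContDiff N (FunctionSpaces.Torus.gradient (fun y => p s y - pℓ s y)) := isContDiff_nat_of_isSmooth hq N
    have hc3' : FunctionSpaces.Torus.IsContDiff N (Torus.tensorDivergence (Rℓ s)) := isContDiff_nat_of_isSmooth (hRs s hs).tensorDivergence N
    have h12 : FunctionSpaces.Torus.IsContDiff N ((fun x => -(FunctionSpaces.Torus.convect (W s) (v s) x)) - FunctionSpaces.Torus.gradient (fun y => p s y - pℓ s y)) := hc1'.sub hc2'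
    have hfun : (fun x => -(FunctionSpaces.Torus.convect (W s) (v s) x) - FunctionSpaces.Torus.gradient (fun y => p s y - pℓ s y) x -
        Torus.tensorDivergence (Rℓ s) x) =
        ((fun x => -(FunctionSpaces.Torus.convect (W s) (v s) x)) - FunctionSpaces.Torus.gradient (fun y => p s y - pℓ s y)) - Torus.tensorDivergence (Rℓ s) := rfl
    rw [hfun]
    have e1 : Torus.eContDiffHolderNorm N α (fun x => -(FunctionSpaces.Torus.convect (W s) (v s) x)) ≤
        ENNReal.ofReal (3 ^ N * ((N + 1) * (2 * T))) := by
      rw [show (fun x => -(FunctionSpaces.Torus.convect (W s) (v s) x)) = -FunctionSpaces.Torus.convect (W s) (v s) from rfl, Torus.eContDiffHolderNorm_neg]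
      exact hconv s hs (v s) (hvs s hs) (hvb s hs)
    have e2 : Torus.eContDiffHolderNorm N α (FunctionSpaces.Torus.gradient (fun y => p s y - pℓ s y)) ≤
        ENNReal.ofReal (CR * (3 ^ N * ((N + 1) * (2 * T)) + 3 * (E * Λ ^ (N + 1)))) := by
      refine (hCR hab hν hγ0 hγ1 hℓ hv s hs).trans ?_
      rw [ENNReal.ofReal_mul (NNReal.coe_nonneg CR), ENNReal.ofReal_coe_nnreal,
        ENNReal.ofReal_add (by positivity) (by positivity)]
      exact mul_le_mul' le_rfl (add_le_add (hconv s hs (vℓ s + v s) ((hℓs s hs).add (hvs s hs)) (hsumb s hs))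
        (hdivR s hs))
    calc _ ≤ Torus.eContDiffHolderNorm N α ((fun x => -(FunctionSpaces.Torus.convect (W s) (v s) x)) - FunctionSpaces.Torus.gradient (fun y => p s y - pℓ s y)) +
          Torus.eContDiffHolderNorm N α (Torus.tensorDivergence (Rℓ s)) := Torus.eContDiffHolderNorm_sub_le h12 hc3'
      _ ≤ (Torus.eContDiffHolderNorm N α (fun x => -(FunctionSpaces.Torus.convect (W s) (v s) x)) +
          Torus.eContDiffHolderNorm N α (FunctionSpaces.Torus.gradient (fun y => p s y - pℓ s y))) +
          Torus.eContDiffHolderNorm N α (Torus.tensorDivergence (Rℓ s)) :=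
          add_le_add (Torus.eContDiffHolderNorm_sub_le hc1' hc2') le_rfl
      _ ≤ (ENNReal.ofReal (3 ^ N * ((N + 1) * (2 * T))) +
          ENNReal.ofReal (CR * (3 ^ N * ((N + 1) * (2 * T)) + 3 * (E * Λ ^ (N + 1))))) +
          ENNReal.ofReal (3 * (E * Λ ^ (N + 1))) := add_le_add (add_le_add e1 e2) (hdivR s hs)
      _ = ENNReal.ofReal G₀ := by
          rw [← ENNReal.ofReal_add (by positivity) (by positivity), ← ENNReal.ofReal_add (by positivity) (by positivity),
            hG₀def]
          congr 1
          ring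
  -- the transport data
  have hK : ∀ s ∈ Icc a b, ∀ x, ‖Torus.fderiv (vℓ s) x‖ ≤ (⟨U, hU0⟩ : ℝ≥0) := by
    intro s hs x
    have h := hvℓ s hs 1 le_rfl (Nat.le_add_left 1 N)
    rw [Nat.sub_self, pow_zero, mul_one] at h
    exact BDSV.norm_fderiv_le_of_eContDiffHolderNorm_one_le hU0 h x
  have hKL : ((⟨U, hU0⟩ : ℝ≥0) : ℝ) * (b - a) ≤ 1 / 2 := by
    change U * L ≤ 1 / 2
    rw [mul_comm]; exact hLU.trans hc1
  set V : ℕ → ℝ := fun j => U * Λ ^ (j - 1) with hVdef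
  have hV0 : ∀ j, 0 ≤ V j := fun j => by positivity
  have hV : ∀ s ∈ Icc a b, ∀ j, 1 ≤ j → j ≤ N → Torus.eContDiffHolderNorm j α (vℓ s) ≤ ENNReal.ofReal (V j) :=
    fun s hs j hj hjN => hvℓ s hs j hj (hjN.trans (Nat.le_succ N))
  have hsmall : (b - a) * V 1 * A ≤ 1 := by
    simp only [hVdef, Nat.sub_self, pow_zero, mul_one]
    calc L * U * A = A * (L * U) := by ring
      _ ≤ A * (1 / A) := mul_le_mul_of_nonneg_left (hLU.trans hc2) hA0.le
      _ = 1 := by field_simp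
  set Φ : ℕ → ℝ := fun m => CΦ * L * E * Λ ^ (m + 1) with hΦdef
  have hΦ0 : ∀ m, 0 ≤ Φ m := fun m => by positivity
  have hΦ' : ∀ s ∈ Icc a b, ∀ m, 1 ≤ m → m < N → Torus.eContDiffHolderNorm m α (W s) ≤ ENNReal.ofReal (Φ m) :=
    fun s hs m _ hmN => hΦ s hs m hmN
  have hF₀ : Torus.eContDiffHolderNorm N α (W a) ≤ ENNReal.ofReal 0 := by
    have hW0 : W a = 0 := by
      funext y
      simp only [hWdef, hanchor, sub_self, Pi.zero_apply]
    rw [hW0, Torus.eContDiffHolderNorm_zero_fun]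
    exact bot_le
  have hTN' := hTN hab hα1 hν hγ0 hγ1 hℓ.smooth_velocity hK hKL hV0 hV hsmall hW hG heq hΦ0 hΦ' le_rfl hG₀0 hF₀ hGb
  -- the lower-order sum
  have hlow : ∑ i ∈ Finset.range (N - 1), V (i + 2) * Φ (N - 1 - i) ≤ (N - 1 : ℕ) * (CΦ * E * Λ ^ (N + 1)) := by
    calc ∑ i ∈ Finset.range (N - 1), V (i + 2) * Φ (N - 1 - i) ≤ ∑ _i ∈ Finset.range (N - 1), CΦ * E * Λ ^ (N + 1) := by
          refine Finset.sum_le_sum fun i hi => ?_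
          have hiN : i < N - 1 := Finset.mem_range.1 hi
          simp only [hVdef, hΦdef]
          have hpow : Λ ^ (i + 2 - 1) * Λ ^ (N - 1 - i + 1) = Λ ^ (N + 1) := by rw [← pow_add]; congr 1; omega
          calc U * Λ ^ (i + 2 - 1) * (CΦ * L * E * Λ ^ (N - 1 - i + 1))
              = CΦ * E * (Λ ^ (i + 2 - 1) * Λ ^ (N - 1 - i + 1)) * (L * U) := by ring
            _ = CΦ * E * Λ ^ (N + 1) * (L * U) := by rw [hpow]
            _ ≤ CΦ * E * Λ ^ (N + 1) * 1 := mul_le_mul_of_nonneg_left hLU1 (by positivity)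
            _ = _ := mul_one _
      _ = (N - 1 : ℕ) * (CΦ * E * Λ ^ (N + 1)) := by rw [Finset.sum_const, Finset.card_range, nsmul_eq_mul]
  -- absorb
  have hN1 : (0 : ℝ) ≤ ((N - 1 : ℕ) : ℝ) := Nat.cast_nonneg _
  have hN1' : ((N - 1 : ℕ) : ℝ) ≤ N := by exact_mod_cast Nat.sub_le N 1
  obtain ⟨X, hXdef⟩ : ∃ X : ℝ, X = A * (0 + L * G₀ + L * ((N - 1 : ℕ) * (CΦ * E * Λ ^ (N + 1)))) := ⟨_, rfl⟩
  have hX0 : 0 ≤ X := by rw [hXdef]; positivity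
  have hWX : ∀ s ∈ Icc a b, Torus.eContDiffHolderNorm N α (W s) ≤ ENNReal.ofReal X := fun s hs => by
    rw [hXdef]
    exact (hTN' s hs).trans (ENNReal.ofReal_le_ofReal (mul_le_mul_of_nonneg_left
      (add_le_add le_rfl (mul_le_mul_of_nonneg_left hlow hL.le)) hA0.le))
  have hMX : M ≤ X := by
    have h1 : S ≤ ENNReal.ofReal X := iSup₂_le fun s hs => hWX s hs
    rw [← hMS] at h1
    exact (ENNReal.ofReal_le_ofReal_iff hX0).1 h1
  -- `X = X' + θ M`, `θ ≤ 1/2`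
  have hXsplit : X = A * L * (P₂ * (N * CΦ) + 3 * (CR + 1) + (N - 1 : ℕ) * CΦ) * (E * Λ ^ (N + 1)) +
      (A * (L * U) * P₂) * M := by
    rw [hXdef, hG₀def, hTdef, hP₂def]
    ring
  have hθ : A * (L * U) * P₂ ≤ 1 / 2 := by
    have h2 : (A * P₂) * (1 / (2 * A * P₂ + 1)) ≤ 1 / 2 := by
      rw [mul_one_div, div_le_iff₀ hden]; linarith
    calc A * (L * U) * P₂ = (A * P₂) * (L * U) := by ring
      _ ≤ (A * P₂) * c := mul_le_mul_of_nonneg_left hLU (by positivity)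
      _ ≤ (A * P₂) * (1 / (2 * A * P₂ + 1)) := mul_le_mul_of_nonneg_left hc3 (by positivity)
      _ ≤ 1 / 2 := h2
  have hcoef : P₂ * (N * CΦ) + 3 * (CR + 1) + (N - 1 : ℕ) * CΦ ≤ P₁ := by
    rw [hP₁def]
    have : ((N - 1 : ℕ) : ℝ) * CΦ ≤ N * CΦ := mul_le_mul_of_nonneg_right hN1' hCΦ
    linarith
  have hELN : 0 ≤ E * Λ ^ (N + 1) := by positivity
  have hM2 : M ≤ 2 * A * P₁ * L * E * Λ ^ (N + 1) := by
    have h4 : (A * (L * U) * P₂) * M ≤ (1 / 2) * M := mul_le_mul_of_nonneg_right hθ hM0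
    have h5 : A * L * (P₂ * (N * CΦ) + 3 * (CR + 1) + (N - 1 : ℕ) * CΦ) * (E * Λ ^ (N + 1)) ≤
        A * L * P₁ * (E * Λ ^ (N + 1)) :=
      mul_le_mul_of_nonneg_right (mul_le_mul_of_nonneg_left hcoef (by positivity)) hELN
    have h1 : M ≤ A * L * P₁ * (E * Λ ^ (N + 1)) + (1 / 2) * M :=
      calc M ≤ X := hMX
        _ = _ := hXsplit
        _ ≤ A * L * P₁ * (E * Λ ^ (N + 1)) + (1 / 2) * M := add_le_add h5 h4
    have h6 : M ≤ 2 * (A * L * P₁ * (E * Λ ^ (N + 1))) := by linarith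
    calc M ≤ 2 * (A * L * P₁ * (E * Λ ^ (N + 1))) := h6
      _ = 2 * A * P₁ * L * E * Λ ^ (N + 1) := by ring
  intro s hs
  exact (hWM s hs).trans (ENNReal.ofReal_le_ofReal hM2)

end Level

/-! ## Prop. 5.3: all levels -/

section AllLevels

/-- **De Rosa Prop. 5.3 (5.10), all levels `≤ N̄`, dimensionless form** (twin of
`BDSV.holderCZBound.stability33_wbound`): for `0 < α < 1` and `N̄` there are `c > 0`, `C ≥ 0` such
that for `(v_ℓ, p_ℓ, R̊_ℓ)` fractional Navier–Stokes–Reynolds and `(v, p)` exact fractional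
Navier–Stokes (`ν ≥ 0`, `0 < γ < 1`) on `[a,b] × T³` with `v(a) = v_ℓ(a)`,
`‖v_ℓ(s)‖_{m,α}, ‖v(s)‖_{m,α} ≤ U Λ^{m-1}` (`1 ≤ m ≤ N̄+1`), `‖R̊_ℓ(s)‖_{m,α} ≤ E Λ^m` (`m ≤ N̄+1`)
and `(b-a)U ≤ c`: `‖(v - v_ℓ)(s)‖_{N,α} ≤ C (b-a) E Λ^{N+1}` for `s ∈ [a,b]`, `N ≤ N̄` (with
`b - a ≤ 2τ_q`, `Λ = ℓ⁻¹`, `E ≂ δ_{q+1}ℓ^α`, `U ≂ δ_q^{1/2}λ_qℓ^{-α}` this is (5.10)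
"`‖vᵢ - v_ℓ‖_{N+α} ≲ τ_q δ_{q+1} ℓ^{-N-1+α}`"). [cite: Derosa2018, §5.2 Prop. 5.3 (5.10)] -/
theorem fracStability_wbound {α : ℝ≥0} (hα : 0 < α) (hα1 : α < 1)
    (Nbar : ℕ) :
    ∃ c : ℝ, 0 < c ∧ ∃ C : ℝ, 0 ≤ C ∧ ∀ {a b : ℝ} (_ : a < b)
      {vℓ v : ℝ → UnitAddTorus (Fin 3) → EuclideanSpace ℝ (Fin 3)} {pℓ p : ℝ → UnitAddTorus (Fin 3) → ℝ}
      {Rℓ : ℝ → UnitAddTorus (Fin 3) → Fin 3 → EuclideanSpace ℝ (Fin 3)} {γ ν : ℝ} (_ : 0 ≤ ν) (_ : 0 < γ) (_ : γ < 1)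
      (_ : Torus.IsFracNSReynoldsOn (Icc a b) γ ν vℓ pℓ Rℓ) (_ : Torus.IsFracNSReynoldsOn (Icc a b) γ ν v p (fun _ _ _ => 0))
      (_ : v a = vℓ a) {U Λ E : ℝ} (_ : 0 < U) (_ : 1 ≤ Λ) (_ : 0 ≤ E)
      (_ : ∀ s ∈ Icc a b, ∀ m, 1 ≤ m → m ≤ Nbar + 1 →
        Torus.eContDiffHolderNorm m α (vℓ s) ≤ ENNReal.ofReal (U * Λ ^ (m - 1)))
      (_ : ∀ s ∈ Icc a b, ∀ m, 1 ≤ m → m ≤ Nbar + 1 →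
        Torus.eContDiffHolderNorm m α (v s) ≤ ENNReal.ofReal (U * Λ ^ (m - 1)))
      (_ : ∀ s ∈ Icc a b, ∀ m, m ≤ Nbar + 1 →
        Torus.eContDiffHolderNorm m α (Rℓ s) ≤ ENNReal.ofReal (E * Λ ^ m))
      (_ : (b - a) * U ≤ c),
      ∀ s ∈ Icc a b, ∀ N, N ≤ Nbar → Torus.eContDiffHolderNorm N α (fun y => v s y - vℓ s y) ≤
        ENNReal.ofReal (C * (b - a) * E * Λ ^ (N + 1)) := by
  induction Nbar with
  | zero =>
    obtain ⟨c, hc0, C, hC0, hlev⟩ := fracStability_level hα hα1 0 (CΦ := 0) le_rfl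
    refine ⟨c, hc0, C, hC0, ?_⟩
    intro a b hab vℓ v pℓ p Rℓ γ ν hν hγ0 hγ1 hℓ hv hanchor U Λ E hU hΛ hE hvℓ hvv hR hc s hs N hN
    have hN0 : N = 0 := Nat.le_zero.1 hN
    subst hN0
    exact hlev hab hν hγ0 hγ1 hℓ hv hanchor hU hΛ hE hvℓ hvv (fun s hs => hR s hs (0 + 1) le_rfl)
      (fun s _ m hm => absurd hm (Nat.not_lt_zero m)) hc s hs
  | succ Nbar IH =>
    obtain ⟨c, hc0, C, hC0, hIH⟩ := IH
    obtain ⟨c₁, hc₁, C₁, hC₁0, hlev⟩ := fracStability_level hα hα1 (Nbar + 1) (CΦ := C) hC0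
    refine ⟨min c c₁, lt_min hc0 hc₁, max C C₁, hC0.trans (le_max_left _ _), ?_⟩
    intro a b hab vℓ v pℓ p Rℓ γ ν hν hγ0 hγ1 hℓ hv hanchor U Λ E hU hΛ hE hvℓ hvv hR hc s hs N hN
    have hL : 0 ≤ b - a := (sub_pos.2 hab).le
    have hΛ0 : 0 ≤ Λ := zero_le_one.trans hΛ
    have hlow : ∀ s ∈ Icc a b, ∀ m, m ≤ Nbar → Torus.eContDiffHolderNorm m α (fun y => v s y - vℓ s y) ≤
        ENNReal.ofReal (C * (b - a) * E * Λ ^ (m + 1)) :=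
      hIH hab hν hγ0 hγ1 hℓ hv hanchor hU hΛ hE (fun s hs m hm hmN => hvℓ s hs m hm (hmN.trans (Nat.le_succ _)))
        (fun s hs m hm hmN => hvv s hs m hm (hmN.trans (Nat.le_succ _)))
        (fun s hs m hmN => hR s hs m (hmN.trans (Nat.le_succ _))) (hc.trans (min_le_left _ _))
    rcases Nat.lt_or_eq_of_le hN with hNlt | hNeq
    · refine (hlow s hs N (Nat.lt_succ_iff.1 hNlt)).trans (ENNReal.ofReal_le_ofReal ?_)
      have : C ≤ max C C₁ := le_max_left _ _
      gcongr
    · rw [hNeq]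
      have h := hlev hab hν hγ0 hγ1 hℓ hv hanchor hU hΛ hE hvℓ hvv (fun s hs => hR s hs (Nbar + 1 + 1) le_rfl)
        (fun s hs m hm => hlow s hs m (Nat.lt_succ_iff.1 hm)) (hc.trans (min_le_right _ _)) s hs
      refine h.trans (ENNReal.ofReal_le_ofReal ?_)
      have : C₁ ≤ max C C₁ := le_max_right _ _
      gcongr

/-- **De Rosa Prop. 5.3, (5.11) and the transport–diffusion derivative, at level `N`, given (5.10)
up to level `N`** (twin of `BDSV.holderCZBound.stability33_level_full`): for `0 < α < 1`, `N` and the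
constant `CW` of the `w`-bounds there is `C ≥ 0` with `‖∇(p - p_ℓ)(s)‖_{N,α} ≤ C E Λ^{N+1}` and
`‖(∂ₜ + v_ℓ·∇ + ν(-Δ)^γ)(v - v_ℓ)(s)‖_{N,α} ≤ C E Λ^{N+1}` whenever `‖v_ℓ‖_{m,α}, ‖v‖_{m,α} ≤ UΛ^{m-1}`
(`1 ≤ m ≤ N+1`), `‖R̊_ℓ‖_{N+1,α} ≤ EΛ^{N+1}`, `‖v - v_ℓ‖_{m,α} ≤ CW (b-a) E Λ^{m+1}` (`m ≤ N`) and
`(b-a)U ≤ 1` (De Rosa: "From (5.13) and (5.14) we then also conclude (5.11) and (5.15)" — the bound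
for `L_{t,ℓ,γ}(vᵢ - v_ℓ)`; the pure material derivative (5.12) follows with Thm. 7.1,
`Torus.exists_eContDiffHolderNorm_fracLaplacian_le`, and the parameter inequality
`τ_q ℓ^{-2γ-2α} ≤ 1`). [cite: Derosa2018, §5.2 Prop. 5.3 (5.11)–(5.12) (proof)] -/
theorem fracStability_level_full {α : ℝ≥0} (hα : 0 < α) (hα1 : α < 1)
    (N : ℕ) {CW : ℝ} (hCW : 0 ≤ CW) :
    ∃ C : ℝ, 0 ≤ C ∧ ∀ {a b : ℝ} (_ : a < b)
      {vℓ v : ℝ → UnitAddTorus (Fin 3) → EuclideanSpace ℝ (Fin 3)} {pℓ p : ℝ → UnitAddTorus (Fin 3) → ℝ}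
      {Rℓ : ℝ → UnitAddTorus (Fin 3) → Fin 3 → EuclideanSpace ℝ (Fin 3)} {γ ν : ℝ} (_ : 0 ≤ ν) (_ : 0 < γ) (_ : γ < 1)
      (_ : Torus.IsFracNSReynoldsOn (Icc a b) γ ν vℓ pℓ Rℓ) (_ : Torus.IsFracNSReynoldsOn (Icc a b) γ ν v p (fun _ _ _ => 0))
      {U Λ E : ℝ} (_ : 0 < U) (_ : 1 ≤ Λ) (_ : 0 ≤ E)
      (_ : ∀ s ∈ Icc a b, ∀ m, 1 ≤ m → m ≤ N + 1 →
        Torus.eContDiffHolderNorm m α (vℓ s) ≤ ENNReal.ofReal (U * Λ ^ (m - 1)))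
      (_ : ∀ s ∈ Icc a b, ∀ m, 1 ≤ m → m ≤ N + 1 →
        Torus.eContDiffHolderNorm m α (v s) ≤ ENNReal.ofReal (U * Λ ^ (m - 1)))
      (_ : ∀ s ∈ Icc a b, Torus.eContDiffHolderNorm (N + 1) α (Rℓ s) ≤ ENNReal.ofReal (E * Λ ^ (N + 1)))
      (_ : ∀ s ∈ Icc a b, ∀ m, m ≤ N →
        Torus.eContDiffHolderNorm m α (fun y => v s y - vℓ s y) ≤ ENNReal.ofReal (CW * (b - a) * E * Λ ^ (m + 1)))
      (_ : (b - a) * U ≤ 1),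
      ∀ s ∈ Icc a b,
        Torus.eContDiffHolderNorm N α (FunctionSpaces.Torus.gradient (fun y => p s y - pℓ s y)) ≤ ENNReal.ofReal (C * E * Λ ^ (N + 1)) ∧
        Torus.eContDiffHolderNorm N α (fun x => FunctionSpaces.Torus.timeDerivWithin (Icc a b) (fun t y => v t y - vℓ t y) s x +
          FunctionSpaces.Torus.convect (vℓ s) (fun y => v s y - vℓ s y) x + ν • Torus.fracLaplacian γ (fun y => v s y - vℓ s y) x) ≤
          ENNReal.ofReal (C * E * Λ ^ (N + 1)) := by
  obtain ⟨CR, hCR⟩ := fracStability_gradient_pressure_le hα hα1 N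
  obtain ⟨P, hPdef⟩ : ∃ P : ℝ, P = 3 ^ N * ((N + 1) * (2 * CW)) := ⟨_, rfl⟩
  have hP0 : 0 ≤ P := by rw [hPdef]; positivity
  refine ⟨P * (1 + CR) + (CR + 1) * 3, by positivity, ?_⟩
  intro a b hab vℓ v pℓ p Rℓ γ ν hν hγ0 hγ1 hℓ hv U Λ E hU hΛ hE hvℓ hvv hR hW hLU1 s hs
  have hL : 0 < b - a := sub_pos.2 hab
  set L := b - a with hLdef
  have hU0 : 0 ≤ U := hU.le
  have hΛ0 : 0 ≤ Λ := zero_le_one.trans hΛ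
  have hvs : FunctionSpaces.Torus.IsSmooth (v s) := hv.smooth_velocity.isSmooth_slice hs
  have hℓs : FunctionSpaces.Torus.IsSmooth (vℓ s) := hℓ.smooth_velocity.isSmooth_slice hs
  have hRs : FunctionSpaces.Torus.IsSmooth (Rℓ s) := hℓ.smooth_stress.isSmooth_slice hs
  have hWs : FunctionSpaces.Torus.IsSmooth (fun y => v s y - vℓ s y) := hvs.sub hℓs
  -- products of complementary orders
  obtain ⟨T, hTdef⟩ : ∃ T : ℝ, T = CW * E * Λ ^ (N + 1) := ⟨_, rfl⟩
  have hT0 : 0 ≤ T := by rw [hTdef]; positivity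
  have hWj : ∀ j, j ≤ N → Torus.eContDiffHolderNorm j α (fun y => v s y - vℓ s y) *
      ENNReal.ofReal (U * Λ ^ (N - j)) ≤ ENNReal.ofReal T := by
    intro j hj
    calc _ ≤ ENNReal.ofReal (CW * L * E * Λ ^ (j + 1)) * ENNReal.ofReal (U * Λ ^ (N - j)) :=
          mul_le_mul' (hW s hs j hj) le_rfl
      _ = ENNReal.ofReal (CW * E * Λ ^ (N + 1) * (L * U)) := by
          rw [← ENNReal.ofReal_mul (by positivity)]
          congr 1
          have hpow : Λ ^ (j + 1) * Λ ^ (N - j) = Λ ^ (N + 1) := by rw [← pow_add]; congr 1; omega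
          calc CW * L * E * Λ ^ (j + 1) * (U * Λ ^ (N - j)) = CW * E * (Λ ^ (j + 1) * Λ ^ (N - j)) * (L * U) := by ring
            _ = _ := by rw [hpow]
      _ ≤ ENNReal.ofReal T := by
          refine ENNReal.ofReal_le_ofReal ?_
          rw [hTdef]
          calc CW * E * Λ ^ (N + 1) * (L * U) ≤ CW * E * Λ ^ (N + 1) * 1 := mul_le_mul_of_nonneg_left hLU1 (by positivity)
            _ = _ := mul_one _
  have hconv : ∀ (u : UnitAddTorus (Fin 3) → EuclideanSpace ℝ (Fin 3)), FunctionSpaces.Torus.IsSmooth u →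
      (∀ m, 1 ≤ m → m ≤ N + 1 → Torus.eContDiffHolderNorm m α u ≤ ENNReal.ofReal (2 * U * Λ ^ (m - 1))) →
      Torus.eContDiffHolderNorm N α (FunctionSpaces.Torus.convect (fun y => v s y - vℓ s y) u) ≤ ENNReal.ofReal (3 ^ N * ((N + 1) * (2 * T))) := by
    intro u hu hub
    have h := Torus.eContDiffHolderNorm_convect_le (u := fun y => v s y - vℓ s y) (v := u)
      (isContDiff_nat_of_isSmooth hWs N) (isContDiff_nat_of_isSmooth hu (N + 1)) α (k := N)
    refine h.trans ?_
    have hterm : ∀ j ∈ Finset.range (N + 1), Torus.eContDiffHolderNorm j α (fun y => v s y - vℓ s y) *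
        Torus.eContDiffHolderNorm (N - j + 1) α u ≤ ENNReal.ofReal (2 * T) := by
      intro j hj
      have hjN : j ≤ N := Nat.lt_succ_iff.1 (Finset.mem_range.1 hj)
      calc _ ≤ Torus.eContDiffHolderNorm j α (fun y => v s y - vℓ s y) * ENNReal.ofReal (2 * U * Λ ^ (N - j)) := by
            refine mul_le_mul' le_rfl ?_
            have h := hub (N - j + 1) (Nat.le_add_left 1 _) (by omega)
            rwa [Nat.add_sub_cancel] at h
        _ = 2 * (Torus.eContDiffHolderNorm j α (fun y => v s y - vℓ s y) * ENNReal.ofReal (U * Λ ^ (N - j))) := by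
            rw [show 2 * U * Λ ^ (N - j) = 2 * (U * Λ ^ (N - j)) by ring, ENNReal.ofReal_mul (by norm_num),
              ENNReal.ofReal_ofNat]
            ring
        _ ≤ 2 * ENNReal.ofReal T := mul_le_mul' le_rfl (hWj j hjN)
        _ = ENNReal.ofReal (2 * T) := by
            rw [ENNReal.ofReal_mul (by norm_num : (0:ℝ) ≤ 2), ENNReal.ofReal_ofNat]
    calc (3 : ℝ≥0∞) ^ N * ∑ j ∈ Finset.range (N + 1), Torus.eContDiffHolderNorm j α (fun y => v s y - vℓ s y) *
          Torus.eContDiffHolderNorm (N - j + 1) α u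
        ≤ 3 ^ N * ∑ _j ∈ Finset.range (N + 1), ENNReal.ofReal (2 * T) :=
          mul_le_mul' le_rfl (Finset.sum_le_sum hterm)
      _ = ENNReal.ofReal (3 ^ N * ((N + 1) * (2 * T))) := by
          rw [Finset.sum_const, Finset.card_range, nsmul_eq_mul]
          rw [ENNReal.ofReal_mul (by positivity : (0 : ℝ) ≤ 3 ^ N), ENNReal.ofReal_pow (by norm_num : (0 : ℝ) ≤ 3),
            ENNReal.ofReal_ofNat, ENNReal.ofReal_mul (by positivity : (0 : ℝ) ≤ (N : ℝ) + 1),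
            show ((N : ℝ) + 1) = ((N + 1 : ℕ) : ℝ) by push_cast; ring, ENNReal.ofReal_natCast]
  have hvb : ∀ m, 1 ≤ m → m ≤ N + 1 →
      Torus.eContDiffHolderNorm m α (v s) ≤ ENNReal.ofReal (2 * U * Λ ^ (m - 1)) := fun m hm hmN =>
    (hvv s hs m hm hmN).trans (ENNReal.ofReal_le_ofReal (by nlinarith [pow_nonneg hΛ0 (m - 1)]))
  have hsumb : ∀ m, 1 ≤ m → m ≤ N + 1 →
      Torus.eContDiffHolderNorm m α (vℓ s + v s) ≤ ENNReal.ofReal (2 * U * Λ ^ (m - 1)) := by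
    intro m hm hmN
    refine (Torus.eContDiffHolderNorm_add_le (isContDiff_nat_of_isSmooth hℓs m)
      (isContDiff_nat_of_isSmooth hvs m)).trans ?_
    rw [show 2 * U * Λ ^ (m - 1) = U * Λ ^ (m - 1) + U * Λ ^ (m - 1) by ring,
      ENNReal.ofReal_add (by positivity) (by positivity)]
    exact add_le_add (hvℓ s hs m hm hmN) (hvv s hs m hm hmN)
  have hdivR : Torus.eContDiffHolderNorm N α (Torus.tensorDivergence (Rℓ s)) ≤ ENNReal.ofReal (3 * (E * Λ ^ (N + 1))) := by
    refine (eContDiffHolderNorm_tensorDivergence_le hRs N α).trans ?_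
    rw [ENNReal.ofReal_mul (by norm_num), ENNReal.ofReal_ofNat]
    exact mul_le_mul' le_rfl (hR s hs)
  -- (3.7)
  have hTP : 3 ^ N * ((N + 1) * (2 * T)) = P * (E * Λ ^ (N + 1)) := by rw [hPdef, hTdef]; ring
  have hgrad : Torus.eContDiffHolderNorm N α (FunctionSpaces.Torus.gradient (fun y => p s y - pℓ s y)) ≤
      ENNReal.ofReal ((CR * (P + 3)) * (E * Λ ^ (N + 1))) := by
    refine (hCR hab hν hγ0 hγ1 hℓ hv s hs).trans ?_
    have h1 := hconv (vℓ s + v s) (hℓs.add hvs) hsumb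
    rw [hTP] at h1
    calc (CR : ℝ≥0∞) * (Torus.eContDiffHolderNorm N α (FunctionSpaces.Torus.convect (fun y => v s y - vℓ s y) (vℓ s + v s)) +
          Torus.eContDiffHolderNorm N α (Torus.tensorDivergence (Rℓ s)))
        ≤ ENNReal.ofReal CR * (ENNReal.ofReal (P * (E * Λ ^ (N + 1))) + ENNReal.ofReal (3 * (E * Λ ^ (N + 1)))) := by
          rw [ENNReal.ofReal_coe_nnreal]
          exact mul_le_mul' le_rfl (add_le_add h1 hdivR)
      _ = ENNReal.ofReal ((CR * (P + 3)) * (E * Λ ^ (N + 1))) := by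
          rw [← ENNReal.ofReal_add (by positivity) (by positivity), ← ENNReal.ofReal_mul (NNReal.coe_nonneg CR)]
          congr 1
          ring
  have hELN : 0 ≤ E * Λ ^ (N + 1) := by positivity
  refine ⟨hgrad.trans (ENNReal.ofReal_le_ofReal ?_), ?_⟩
  · have h1 : (CR : ℝ) * (P + 3) ≤ P * (1 + CR) + (CR + 1) * 3 := by nlinarith [NNReal.coe_nonneg CR, hP0]
    calc (CR : ℝ) * (P + 3) * (E * Λ ^ (N + 1)) ≤ (P * (1 + CR) + (CR + 1) * 3) * (E * Λ ^ (N + 1)) :=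
          mul_le_mul_of_nonneg_right h1 hELN
      _ = _ := by ring
  -- (3.8)
  have hform : (fun x => FunctionSpaces.Torus.timeDerivWithin (Icc a b) (fun t y => v t y - vℓ t y) s x +
      FunctionSpaces.Torus.convect (vℓ s) (fun y => v s y - vℓ s y) x + ν • Torus.fracLaplacian γ (fun y => v s y - vℓ s y) x) =
      ((fun x => -(FunctionSpaces.Torus.convect (fun y => v s y - vℓ s y) (v s) x)) - FunctionSpaces.Torus.gradient (fun y => p s y - pℓ s y)) -
        Torus.tensorDivergence (Rℓ s) := by
    funext x
    rw [fracStability_transport_eq hab hγ0.le hℓ hv s hs x]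
    rfl
  rw [hform]
  have hc1' : FunctionSpaces.Torus.IsContDiff N (fun x => -(FunctionSpaces.Torus.convect (fun y => v s y - vℓ s y) (v s) x)) :=
    isContDiff_nat_of_isSmooth (hWs.convect hvs).neg N
  have hq : FunctionSpaces.Torus.IsSmooth (FunctionSpaces.Torus.gradient (fun y => p s y - pℓ s y)) :=
    ((hv.smooth_pressure.isSmooth_slice hs).sub (hℓ.smooth_pressure.isSmooth_slice hs)).gradient
  have hc2' : FunctionSpaces.Torus.IsContDiff N (FunctionSpaces.Torus.gradient (fun y => p s y - pℓ s y)) := isContDiff_nat_of_isSmooth hq N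
  have hc3' : FunctionSpaces.Torus.IsContDiff N (Torus.tensorDivergence (Rℓ s)) := isContDiff_nat_of_isSmooth hRs.tensorDivergence N
  have e1 : Torus.eContDiffHolderNorm N α (fun x => -(FunctionSpaces.Torus.convect (fun y => v s y - vℓ s y) (v s) x)) ≤
      ENNReal.ofReal (P * (E * Λ ^ (N + 1))) := by
    rw [show (fun x => -(FunctionSpaces.Torus.convect (fun y => v s y - vℓ s y) (v s) x)) = -FunctionSpaces.Torus.convect (fun y => v s y - vℓ s y) (v s) from rfl,
      Torus.eContDiffHolderNorm_neg, ← hTP]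
    exact hconv (v s) hvs hvb
  calc _ ≤ Torus.eContDiffHolderNorm N α ((fun x => -(FunctionSpaces.Torus.convect (fun y => v s y - vℓ s y) (v s) x)) -
        FunctionSpaces.Torus.gradient (fun y => p s y - pℓ s y)) + Torus.eContDiffHolderNorm N α (Torus.tensorDivergence (Rℓ s)) :=
        Torus.eContDiffHolderNorm_sub_le (hc1'.sub hc2') hc3'
    _ ≤ (Torus.eContDiffHolderNorm N α (fun x => -(FunctionSpaces.Torus.convect (fun y => v s y - vℓ s y) (v s) x)) +
        Torus.eContDiffHolderNorm N α (FunctionSpaces.Torus.gradient (fun y => p s y - pℓ s y))) +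
        Torus.eContDiffHolderNorm N α (Torus.tensorDivergence (Rℓ s)) :=
        add_le_add (Torus.eContDiffHolderNorm_sub_le hc1' hc2') le_rfl
    _ ≤ (ENNReal.ofReal (P * (E * Λ ^ (N + 1))) + ENNReal.ofReal ((CR * (P + 3)) * (E * Λ ^ (N + 1)))) +
        ENNReal.ofReal (3 * (E * Λ ^ (N + 1))) := add_le_add (add_le_add e1 hgrad) hdivR
    _ = ENNReal.ofReal ((P * (1 + CR) + (CR + 1) * 3) * E * Λ ^ (N + 1)) := by
        rw [← ENNReal.ofReal_add (by positivity) (by positivity), ← ENNReal.ofReal_add (by positivity) (by positivity)]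
        congr 1
        ring

/-- A uniform constant for `DeRosa.fracStability_level_full` over the levels `≤ N̄`.
[cite: Derosa2018, §5.2 Prop. 5.3] -/
theorem fracStability_level_full_uniform {α : ℝ≥0} (hα : 0 < α)
    (hα1 : α < 1) {CW : ℝ} (hCW : 0 ≤ CW) (Nbar : ℕ) :
    ∃ CF : ℝ, 0 ≤ CF ∧ ∀ N, N ≤ Nbar → ∃ C : ℝ, 0 ≤ C ∧ C ≤ CF ∧ ∀ {a b : ℝ} (_ : a < b)
      {vℓ v : ℝ → UnitAddTorus (Fin 3) → EuclideanSpace ℝ (Fin 3)} {pℓ p : ℝ → UnitAddTorus (Fin 3) → ℝ}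
      {Rℓ : ℝ → UnitAddTorus (Fin 3) → Fin 3 → EuclideanSpace ℝ (Fin 3)} {γ ν : ℝ} (_ : 0 ≤ ν) (_ : 0 < γ) (_ : γ < 1)
      (_ : Torus.IsFracNSReynoldsOn (Icc a b) γ ν vℓ pℓ Rℓ) (_ : Torus.IsFracNSReynoldsOn (Icc a b) γ ν v p (fun _ _ _ => 0))
      {U Λ E : ℝ} (_ : 0 < U) (_ : 1 ≤ Λ) (_ : 0 ≤ E)
      (_ : ∀ s ∈ Icc a b, ∀ m, 1 ≤ m → m ≤ N + 1 →
        Torus.eContDiffHolderNorm m α (vℓ s) ≤ ENNReal.ofReal (U * Λ ^ (m - 1)))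
      (_ : ∀ s ∈ Icc a b, ∀ m, 1 ≤ m → m ≤ N + 1 →
        Torus.eContDiffHolderNorm m α (v s) ≤ ENNReal.ofReal (U * Λ ^ (m - 1)))
      (_ : ∀ s ∈ Icc a b, Torus.eContDiffHolderNorm (N + 1) α (Rℓ s) ≤ ENNReal.ofReal (E * Λ ^ (N + 1)))
      (_ : ∀ s ∈ Icc a b, ∀ m, m ≤ N →
        Torus.eContDiffHolderNorm m α (fun y => v s y - vℓ s y) ≤ ENNReal.ofReal (CW * (b - a) * E * Λ ^ (m + 1)))
      (_ : (b - a) * U ≤ 1),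
      ∀ s ∈ Icc a b,
        Torus.eContDiffHolderNorm N α (FunctionSpaces.Torus.gradient (fun y => p s y - pℓ s y)) ≤ ENNReal.ofReal (C * E * Λ ^ (N + 1)) ∧
        Torus.eContDiffHolderNorm N α (fun x => FunctionSpaces.Torus.timeDerivWithin (Icc a b) (fun t y => v t y - vℓ t y) s x +
          FunctionSpaces.Torus.convect (vℓ s) (fun y => v s y - vℓ s y) x + ν • Torus.fracLaplacian γ (fun y => v s y - vℓ s y) x) ≤
          ENNReal.ofReal (C * E * Λ ^ (N + 1)) := by
  induction Nbar with
  | zero =>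
    obtain ⟨C, hC0, h⟩ := fracStability_level_full hα hα1 0 hCW
    exact ⟨C, hC0, fun N hN => ⟨C, hC0, le_rfl, by rw [Nat.le_zero.1 hN]; exact h⟩⟩
  | succ Nb IHb =>
    obtain ⟨CF, hCF0, hCF⟩ := IHb
    obtain ⟨C, hC0, h⟩ := fracStability_level_full hα hα1 (Nb + 1) hCW
    refine ⟨max CF C, hCF0.trans (le_max_left _ _), fun N hN => ?_⟩
    rcases Nat.lt_or_eq_of_le hN with hlt | heq
    · obtain ⟨C', hC'0, hC'F, h'⟩ := hCF N (Nat.lt_succ_iff.1 hlt)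
      exact ⟨C', hC'0, hC'F.trans (le_max_left _ _), h'⟩
    · exact ⟨C, hC0, le_max_right _ _, by rw [heq]; exact h⟩

/-- **De Rosa 2019, Prop. 5.3 (stability of the exact solutions of the fractional Navier–Stokes
system relative to `v_ℓ`) in dimensionless form** (twin of `BDSV.holderCZBound.stability33`,
unconditional): for `0 < α < 1` and `N̄` there are `c > 0`, `C ≥ 0` such that for every `ν ≥ 0`,
`0 < γ < 1`, every fractional Navier–Stokes–Reynolds triple `(v_ℓ, p_ℓ, R̊_ℓ)`
(`∂ₜv_ℓ + div(v_ℓ ⊗ v_ℓ) + ∇p_ℓ + ν(-Δ)^γ v_ℓ = div R̊_ℓ`) and every exact solution `(v, p)` of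
`∂ₜv + div(v ⊗ v) + ∇p + ν(-Δ)^γ v = 0`, `div v = 0` on `[a,b] × T³` with `v(a) = v_ℓ(a)` (De Rosa
(5.9): `vᵢ(·, tᵢ) = v_ℓ(·, tᵢ)`, estimates forward in time "for `0 ≤ t - tᵢ ≤ 2τ_q`"),
`‖v_ℓ(s)‖_{m,α}, ‖v(s)‖_{m,α} ≤ U Λ^{m-1}` (`1 ≤ m ≤ N̄+1`), `‖R̊_ℓ(s)‖_{m,α} ≤ E Λ^m` (`m ≤ N̄+1`) and
`(b - a) U ≤ c`, for all `s ∈ [a,b]` and `N ≤ N̄`: (5.10) `‖(v - v_ℓ)(s)‖_{N,α} ≤ C (b-a) E Λ^{N+1}`,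
(5.11) `‖∇(p - p_ℓ)(s)‖_{N,α} ≤ C E Λ^{N+1}`, and `‖(∂ₜ + v_ℓ·∇ + ν(-Δ)^γ)(v - v_ℓ)(s)‖_{N,α} ≤ C E Λ^{N+1}`
(the bound for `L_{t,ℓ,γ}(vᵢ - v_ℓ)` from which the paper deduces (5.12) with Thm. 7.1).
[cite: Derosa2018, §5.2 Prop. 5.3 (5.10)–(5.12)] -/
theorem fracStability {α : ℝ≥0} (hα : 0 < α) (hα1 : α < 1) (Nbar : ℕ) :
    ∃ c : ℝ, 0 < c ∧ ∃ C : ℝ, 0 ≤ C ∧ ∀ {a b : ℝ} (_ : a < b)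
      {vℓ v : ℝ → UnitAddTorus (Fin 3) → EuclideanSpace ℝ (Fin 3)} {pℓ p : ℝ → UnitAddTorus (Fin 3) → ℝ}
      {Rℓ : ℝ → UnitAddTorus (Fin 3) → Fin 3 → EuclideanSpace ℝ (Fin 3)} {γ ν : ℝ} (_ : 0 ≤ ν) (_ : 0 < γ) (_ : γ < 1)
      (_ : Torus.IsFracNSReynoldsOn (Icc a b) γ ν vℓ pℓ Rℓ) (_ : Torus.IsFracNSReynoldsOn (Icc a b) γ ν v p (fun _ _ _ => 0))
      (_ : v a = vℓ a) {U Λ E : ℝ} (_ : 0 < U) (_ : 1 ≤ Λ) (_ : 0 ≤ E)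
      (_ : ∀ s ∈ Icc a b, ∀ m, 1 ≤ m → m ≤ Nbar + 1 →
        Torus.eContDiffHolderNorm m α (vℓ s) ≤ ENNReal.ofReal (U * Λ ^ (m - 1)))
      (_ : ∀ s ∈ Icc a b, ∀ m, 1 ≤ m → m ≤ Nbar + 1 →
        Torus.eContDiffHolderNorm m α (v s) ≤ ENNReal.ofReal (U * Λ ^ (m - 1)))
      (_ : ∀ s ∈ Icc a b, ∀ m, m ≤ Nbar + 1 →
        Torus.eContDiffHolderNorm m α (Rℓ s) ≤ ENNReal.ofReal (E * Λ ^ m))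
      (_ : (b - a) * U ≤ c),
      ∀ s ∈ Icc a b, ∀ N, N ≤ Nbar →
        Torus.eContDiffHolderNorm N α (fun y => v s y - vℓ s y) ≤ ENNReal.ofReal (C * (b - a) * E * Λ ^ (N + 1)) ∧
        Torus.eContDiffHolderNorm N α (FunctionSpaces.Torus.gradient (fun y => p s y - pℓ s y)) ≤ ENNReal.ofReal (C * E * Λ ^ (N + 1)) ∧
        Torus.eContDiffHolderNorm N α (fun x => FunctionSpaces.Torus.timeDerivWithin (Icc a b) (fun t y => v t y - vℓ t y) s x +
          FunctionSpaces.Torus.convect (vℓ s) (fun y => v s y - vℓ s y) x + ν • Torus.fracLaplacian γ (fun y => v s y - vℓ s y) x) ≤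
          ENNReal.ofReal (C * E * Λ ^ (N + 1)) := by
  obtain ⟨c, hc0, CW, hCW0, hWb⟩ := fracStability_wbound hα hα1 Nbar
  obtain ⟨CF, hCF0, hCF⟩ := fracStability_level_full_uniform hα hα1 hCW0 Nbar
  refine ⟨min c 1, lt_min hc0 one_pos, max CW CF, hCW0.trans (le_max_left _ _), ?_⟩
  intro a b hab vℓ v pℓ p Rℓ γ ν hν hγ0 hγ1 hℓ hv hanchor U Λ E hU hΛ hE hvℓ hvv hR hc s hs N hN
  have hL : 0 ≤ b - a := (sub_pos.2 hab).le
  have hΛ0 : 0 ≤ Λ := zero_le_one.trans hΛ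
  have hW := hWb hab hν hγ0 hγ1 hℓ hv hanchor hU hΛ hE hvℓ hvv hR (hc.trans (min_le_left _ _))
  obtain ⟨C, hC0, hCle, hlev⟩ := hCF N hN
  have h2 := hlev hab hν hγ0 hγ1 hℓ hv hU hΛ hE (fun s hs m hm hmN => hvℓ s hs m hm (by omega))
    (fun s hs m hm hmN => hvv s hs m hm (by omega)) (fun s hs => hR s hs (N + 1) (by omega))
    (fun s hs m hm => hW s hs m (hm.trans hN)) (hc.trans (min_le_right _ _)) s hs
  have hELN : 0 ≤ E * Λ ^ (N + 1) := by positivity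
  have hCmax : C ≤ max CW CF := hCle.trans (le_max_right _ _)
  refine ⟨(hW s hs N hN).trans (ENNReal.ofReal_le_ofReal ?_), h2.1.trans (ENNReal.ofReal_le_ofReal ?_),
    h2.2.trans (ENNReal.ofReal_le_ofReal ?_)⟩
  · have : CW ≤ max CW CF := le_max_left _ _
    gcongr
  · gcongr
  · gcongr

end AllLevels

end DeRosa

end Literature.Analysis.FluidPDE
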